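import Mathlib.NumberTheory.Padics.RingHoms
import HarnessLib

/-!
# R90-TF · S3 · THEOREMS — `R90S3PadicRootPrecision` ((U3-F) split, the precision `M₀(r⃗)`): finitely many DISTINCT `p`-adic integers stay distinct modulo `p^M`
# for all `M ≥ M₀`

R90-TF section S3 (offered on the R90 bus 2026-09-05T01:33:59Z ∕ 01:37Z to the captain K2E3-p17 (g11)'s quantifier spine «`r⃗` → `M₀(r⃗)` (B12) → `g`»); crux H413
(`stmt-HodgeConjecture-24833`, lane `--supports … --as helper`), route `HCCMUnconditional`.  Serves the choice of the dyadic precision `M` in the assembly P8 of the (U3-F)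
socket `stub_R90_S3_auxGlobaliseField` (`Cruxes/H413/Lines/R90_S3_LocalTransportWaveG.lean` :645): the dyadic target roots `rᵢ` of ★ `exists_dyadicTarget` are pairwise
distinct in `ℤ₂`, and Hensel∕Krasner at `2` (B12) wants them distinct MODULO `2^M`.  THEOREMS ONLY (no `def`, no `instance`, no notation, no named fact, no `sorry`);
Mathlib imports only; never imports `Cruxes/…/Lines`.

THE MATHEMATICS [folklore; Neukirch1999 Ch. II (5.7)].  `x ≡ y (mod p^M)` iff `|x − y| ≤ p^{−M}` (Mathlib `PadicInt.norm_le_pow_iff_mem_span_pow`, `PadicInt.ker_toZModPow`);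
for `x ≠ y` some `p^{−M₀} < |x − y|` (`PadicInt.exists_pow_neg_lt`), and then `x ≢ y (mod p^M)` for every `M ≥ M₀`; over a finite index set take the maximum of the
pairwise `M₀`.
* `toZModPow_eq_iff_norm_sub_le`, `toZModPow_ne_of_pow_neg_lt_norm_sub`, `exists_forall_toZModPow_ne`, **`exists_forall_injective_toZModPow`**.

HONEST LABEL: HC_CM is proved only modulo the 7 printed citations (2 remaining named inputs: hLiu418 = stmt-HodgeConjecture-24832, h413 =
stmt-HodgeConjecture-24833) until rung 0 closes; glue toward the GENUINE residual (U3-F); proves nothing printed; count-neutral.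

## References
* [Neukirch1999] J. Neukirch, *Algebraic Number Theory* (1999), Ch. II (5.7).
-/

set_option autoImplicit false
-- the mandated namespace repeats the single-problem summit's segment (`HodgeConjecture.HodgeConjecture`)
set_option linter.dupNamespace false

noncomputable section

namespace Summit.HodgeConjecture.HodgeConjecture.R90.S3

variable {p : ℕ} [hp : Fact p.Prime]

/-- `x ≡ y (mod p^M)` iff `|x − y| ≤ p^{−M}`. [cite: Neukirch1999, Ch. II (5.7)] -/
theorem toZModPow_eq_iff_norm_sub_le (M : ℕ) (x y : ℤ_[p]) :
    PadicInt.toZModPow M x = PadicInt.toZModPow M y ↔ ‖x - y‖ ≤ (p : ℝ) ^ (-(M : ℤ)) := by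
  rw [PadicInt.norm_le_pow_iff_mem_span_pow, ← PadicInt.ker_toZModPow, RingHom.mem_ker, map_sub, sub_eq_zero]

/-- If `p^{−M} < |x − y|` then `x ≢ y (mod p^M)`. [folklore] -/
theorem toZModPow_ne_of_pow_neg_lt_norm_sub {M : ℕ} {x y : ℤ_[p]} (h : (p : ℝ) ^ (-(M : ℤ)) < ‖x - y‖) :
    PadicInt.toZModPow M x ≠ PadicInt.toZModPow M y := fun heq =>
  (not_le.2 h) ((toZModPow_eq_iff_norm_sub_le M x y).1 heq)

/-- Two DISTINCT `p`-adic integers are distinct modulo `p^M` for all large `M`. [folklore] -/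
theorem exists_forall_toZModPow_ne {x y : ℤ_[p]} (hxy : x ≠ y) : ∃ M₀ : ℕ, ∀ M : ℕ, M₀ ≤ M → PadicInt.toZModPow M x ≠ PadicInt.toZModPow M y := by
  have hpos : 0 < ‖x - y‖ := norm_pos_iff.2 (sub_ne_zero.2 hxy)
  obtain ⟨M₀, hM₀⟩ := PadicInt.exists_pow_neg_lt p hpos
  refine ⟨M₀, fun M hM => toZModPow_ne_of_pow_neg_lt_norm_sub (lt_of_le_of_lt ?_ hM₀)⟩
  have hp1 : (1 : ℝ) ≤ p := by exact_mod_cast hp.out.one_lt.le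
  exact zpow_le_zpow_right₀ hp1 (by omega)

/-- **The precision `M₀(r⃗)`.**  A finite family of pairwise DISTINCT `p`-adic integers `r : ι → ℤ_[p]` stays pairwise distinct modulo `p^M` for every `M ≥ M₀`:
`Function.Injective (toZModPow M ∘ r)`. [cite: Neukirch1999, Ch. II (5.7)] -/
theorem exists_forall_injective_toZModPow {ι : Type*} [Fintype ι] (r : ι → ℤ_[p]) (hr : Function.Injective r) :
    ∃ M₀ : ℕ, ∀ M : ℕ, M₀ ≤ M → Function.Injective fun i => PadicInt.toZModPow M (r i) := by
  classical
  -- a pairwise bound `B i j` for `i ≠ j` (and `0` on the diagonal), then the maximum over all pairs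
  have hpair : ∀ ij : ι × ι, ∃ B : ℕ, ij.1 ≠ ij.2 → ∀ M : ℕ, B ≤ M → PadicInt.toZModPow M (r ij.1) ≠ PadicInt.toZModPow M (r ij.2) := fun ij => by
    by_cases h : ij.1 = ij.2
    · exact ⟨0, fun hne => (hne h).elim⟩
    · obtain ⟨B, hB⟩ := exists_forall_toZModPow_ne (fun heq => h (hr heq))
      exact ⟨B, fun _ => hB⟩
  choose B hB using hpair
  refine ⟨Finset.univ.sup B, fun M hM i j hij => ?_⟩
  by_contra hne
  have hle : B (i, j) ≤ M := le_trans (Finset.le_sup (Finset.mem_univ (i, j))) hM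
  exact hB (i, j) hne M hle hij

end Summit.HodgeConjecture.HodgeConjecture.R90.S3

end
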